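import Mathlib
import HarnessLib

/-!
# S1a — R4c cusp UNITS brick: a member generator `a′` with `a′ · ξ^e = r` is a unit wherever the RESIDUAL factor of `r` is, once `r = S^{ne}·Z` and
# `ξ = Sⁿ·H` split off the exceptional generator `S` (integral scheme: cancel `S^{ne}`)

[OURS · L1 W4.5c · leafhand-res-wildquotients-7 g0; folklore] — NOT a statement of the manuscript; counted 0; AI-level work, weaker than expert review.
Crux stmt-ResolutionOfSingularities-17941 `CyclicQuotientFourfolds`, line `s1a-logminvertex` v13 (`stub_reachLowerInFX`), R4c `cusp_killsIn_two` (crux-dir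
skeleton v2, `Lines/s1a_logminvertex-R4c-PROGRESS-v2.md`, UNITS obligation). The three cusp members (✓`exists_cuspO_memberChart_rel_xi`, ✓`exists_cuspQ_memberChart_rel`,
✓`exists_cuspQv_memberChart_rel`) export their generators `a′, bb ∈ Γ(U_c)` only through the RELATIONS `a′ · (π^*ξ)|³ = (π^*x₀)|`, `bb · (π^*ξ)|² = (π^*f)|`
against pulled-back root sections; on the producer chart these pull-backs factor through the exceptional generator `s`: `π^*x₀ = s^{w₀}·u₀′`,
`π^*ξ = s^{w_ξ}·h`, `π^*f = s^{w_f}·t̂` with `w₀ = 3w_ξ`, `w_f = 2w_ξ` (`(9,3,6)` at `O`, `(3,1,2)` at `Q`). Since the model is INTEGRAL, `s^{w₀}` cancels: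
`a′·h³ = u₀′` and `bb·h² = t̂` on `U_c`, so `a′` is a unit on `U_c ∩ D(u₀′) = U_c ∩ D(z₀)` and `bb` on `U_c ∩ D(t̂) = U_c ∩ D(z₁)` — the UNITS clauses of
✓`killsIn_one_of_sectionCharts_of_associated` for the cover sets `O′ᵢⱼ ∩ D(z₀)`, `O′ᵢⱼ ∩ D(z₁)` at the member's own chart.

* ★ `mem_basicOpen_of_mul_pow_eq_of_split` — the scheme-level statement: `V` integral, `U ≤ W`, `a ∈ Γ(U)`, `r, ξ, S, Z, H ∈ Γ(W)` with
  `a · (ξ|_U)^e = r|_U`, `r = S^{n·e} · Z`, `ξ = S^n · H`, `S ≠ 0`; then every `v ∈ U ∩ D(Z)` lies in `D(a)` (and in `D(H)`).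
-/

set_option linter.dupNamespace false

noncomputable section

universe u

open CategoryTheory AlgebraicGeometry TopologicalSpace Opposite

namespace Summit.ResolutionOfSingularities.ResolutionOfSingularities.Theorems.WildQuotientResolution.S1.BlowupCharts

/-- On an integral scheme, restriction of sections to a nonempty smaller open is injective (through the injectivity of germs). [folklore] -/
theorem map_injective_of_isIntegral {V : Scheme.{u}} [IsIntegral V] {U W : V.Opens} (hUW : U ≤ W) {v : V} (hv : v ∈ U) :
    Function.Injective (V.presheaf.map (homOfLE hUW).op) := by
  intro x y hxy
  have h := congrArg (V.presheaf.germ U v hv) hxy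
  rw [TopCat.Presheaf.germ_res_apply, TopCat.Presheaf.germ_res_apply] at h
  exact AlgebraicGeometry.germ_injective_of_isIntegral V v (hUW hv) h

/-- ★ **A member generator is a unit wherever the residual factor of its pin is.** Let `V` be an integral scheme, `U ≤ W` opens, `a ∈ Γ(U)` and
`r, ξ, S, Z, H ∈ Γ(W)` with `a · (ξ|_U)^e = r|_U` (`0 < e`), `r = S^{n·e} · Z` and `ξ = S^n · H`, `S ≠ 0`. Then `a · (H|_U)^e = Z|_U` (cancel `S^{n·e} ≠ 0` in the
domain `Γ(U)`), so every point of `U ∩ D(Z)` lies in `D(a)` and in `D(H)`. (R4c: `a = a′`, `ξ = π^*ξ_O`, `r = π^*x₀`, `S = s`, `Z = u₀′`, `H = h`,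
`(n, e) = (3, 3)` at `O`; `a = bb`, `r = π^*f`, `Z = t̂`, `(n, e) = (3, 2)`; at `Q` with `n = 1`.) [OURS · L1 W4.5c · R4c; folklore] -/
theorem mem_basicOpen_of_mul_pow_eq_of_split {V : Scheme.{u}} [IsIntegral V] {U W : V.Opens} (hUW : U ≤ W) (a : Γ(V, U))
    (r ξ S Z H : Γ(V, W)) (n e : ℕ) (he : 0 < e)
    (hrel : a * (V.presheaf.map (homOfLE hUW).op ξ) ^ e = V.presheaf.map (homOfLE hUW).op r)
    (hr : r = S ^ (n * e) * Z) (hξ : ξ = S ^ n * H) (hS : S ≠ 0) {v : V} (hv : v ∈ U) (hvZ : v ∈ V.basicOpen Z) :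
    v ∈ V.basicOpen a ∧ v ∈ V.basicOpen H := by
  haveI : Nonempty U := ⟨⟨v, hv⟩⟩
  -- cancel `S^{ne}` in the domain `Γ(U)`
  have hSU : V.presheaf.map (homOfLE hUW).op S ≠ 0 := fun h0 =>
    hS (map_injective_of_isIntegral hUW hv (by rw [h0, map_zero]))
  have hkey : a * (V.presheaf.map (homOfLE hUW).op H) ^ e = V.presheaf.map (homOfLE hUW).op Z := by
    have h1 : (a * (V.presheaf.map (homOfLE hUW).op H) ^ e) * (V.presheaf.map (homOfLE hUW).op S) ^ (n * e) =
        V.presheaf.map (homOfLE hUW).op Z * (V.presheaf.map (homOfLE hUW).op S) ^ (n * e) := by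
      have := hrel
      rw [hξ, hr, map_mul, map_pow, map_mul, map_pow] at this
      linear_combination this
    exact mul_right_cancel₀ (pow_ne_zero _ hSU) h1
  -- `v ∈ D(Z|_U) = D(a) ∩ D(H|_U^e)`
  have hvZ' : v ∈ V.basicOpen (V.presheaf.map (homOfLE hUW).op Z) := by
    rw [Scheme.basicOpen_res]; exact ⟨hv, hvZ⟩
  rw [← hkey, Scheme.basicOpen_mul] at hvZ'
  rw [Scheme.basicOpen_pow _ _ he, Scheme.basicOpen_res] at hvZ'
  exact ⟨hvZ'.1, hvZ'.2.2⟩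

end Summit.ResolutionOfSingularities.ResolutionOfSingularities.Theorems.WildQuotientResolution.S1.BlowupCharts

end
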